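import Mathlib.Topology.NoetherianSpace
import Mathlib.Topology.Sober
import HarnessLib

/-!
# Generic points in closures of locally closed sets of a Noetherian sober space

Topic: `Literature/AlgebraicGeometry/Resolution` (point-set lemmas for Zariski's patching
argument). In a Noetherian quasi-sober space `X` (e.g. a Noetherian scheme), for `F` closed and
`G` open:

* `exists_mem_inter_specializes_of_mem_closure` — every point of the closure of `F ∩ G` is a
  specialization of a point of `F ∩ G` itself (the generic points of the irreducible components
  of `cl(F ∩ G)` lie in `F ∩ G`);
* `finite_setOf_maximal_inter` — the points of `F ∩ G` which are maximal under generization in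
  `F ∩ G` (the generic points of its irreducible components) form a finite set.

Both by Noetherian induction on `F`. These are the two finiteness/closure facts behind "the
fundamental locus contains finitely many curves" and "bad points" in Piltant's axiomatization of
Zariski's patching (Piltant 2013, proof of Prop. 5.1, Steps 3–5). All PROVED. [folklore]

## References

* O. Piltant, RACSAM 107 (2013), proof of Prop. 5.1. [Piltant2013]
* The Stacks Project, Tag 0052 (Noetherian spaces: finitely many irreducible components).
  [StacksProject]
-/

namespace Literature.AlgebraicGeometry.Resolution

open TopologicalSpace Topology

universe u

variable {X : Type u} [TopologicalSpace X]

/-- In a quasi-sober space the generic point of an irreducible closed set meeting an open set `G`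
lies in `G`. [folklore] -/
theorem mem_of_isGenericPoint_of_isOpen {F G : Set X} {ξ : X} (hξ : IsGenericPoint ξ F)
    (hG : IsOpen G) (hne : (F ∩ G).Nonempty) : ξ ∈ G := by
  obtain ⟨e, heF, heG⟩ := hne
  exact (hξ.specializes heF).mem_open hG heG

/-- **Points of the closure of `F ∩ G` (`F` closed, `G` open) are specializations of points of
`F ∩ G`**, in a Noetherian quasi-sober space. [folklore] -/
theorem exists_mem_inter_specializes_of_mem_closure [NoetherianSpace X] [QuasiSober X]
    {F G : Set X} (hF : IsClosed F) (hG : IsOpen G) {t : X} (ht : t ∈ closure (F ∩ G)) :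
    ∃ ξ ∈ F ∩ G, ξ ⤳ t := by
  lift F to Closeds X using hF
  induction F using WellFoundedLT.induction generalizing t with
  | _ F ih =>
  by_cases hirr : IsPreirreducible (F : Set X)
  · have hne : ((F : Set X) ∩ G).Nonempty := by
      by_contra h
      rw [Set.not_nonempty_iff_eq_empty] at h
      rw [h, closure_empty] at ht
      exact ht
    have hFirr : IsIrreducible (F : Set X) := ⟨hne.mono Set.inter_subset_left, hirr⟩
    obtain ⟨ξ, hξ⟩ := QuasiSober.sober hFirr F.isClosed
    have htF : t ∈ (F : Set X) := closure_minimal Set.inter_subset_left F.isClosed ht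
    exact ⟨ξ, ⟨hξ.mem, mem_of_isGenericPoint_of_isOpen hξ hG hne⟩, hξ.specializes htF⟩
  · rw [isPreirreducible_iff_isClosed_union_isClosed] at hirr
    push Not at hirr
    obtain ⟨z₁, z₂, hz₁, hz₂, hsub, h₁, h₂⟩ := hirr
    have hlt : ∀ {z : Set X} (hz : IsClosed z), ¬ (F : Set X) ⊆ z → F ⊓ (⟨z, hz⟩ : Closeds X) < F :=
      fun hz h => inf_lt_left.2 (fun hle => h hle)
    have hsplit : (F : Set X) ∩ G = ((F : Set X) ∩ z₁ ∩ G) ∪ ((F : Set X) ∩ z₂ ∩ G) := by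
      ext p
      simp only [Set.mem_inter_iff, Set.mem_union]
      constructor
      · rintro ⟨hpF, hpG⟩
        rcases hsub hpF with h | h
        exacts [Or.inl ⟨⟨hpF, h⟩, hpG⟩, Or.inr ⟨⟨hpF, h⟩, hpG⟩]
      · rintro (⟨⟨hpF, -⟩, hpG⟩ | ⟨⟨hpF, -⟩, hpG⟩) <;> exact ⟨hpF, hpG⟩
    rw [hsplit, closure_union] at ht
    rcases ht with ht | ht
    · obtain ⟨ξ, ⟨hξF, hξG⟩, hξt⟩ := ih (F ⊓ ⟨z₁, hz₁⟩) (hlt hz₁ h₁) ht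
      exact ⟨ξ, ⟨hξF.1, hξG⟩, hξt⟩
    · obtain ⟨ξ, ⟨hξF, hξG⟩, hξt⟩ := ih (F ⊓ ⟨z₂, hz₂⟩) (hlt hz₂ h₂) ht
      exact ⟨ξ, ⟨hξF.1, hξG⟩, hξt⟩

/-- **The maximal points of `F ∩ G` are finite in number** (`F` closed, `G` open, `X` Noetherian
quasi-sober): they are generic points of irreducible components. [folklore] -/
theorem finite_setOf_maximal_inter [NoetherianSpace X] [QuasiSober X] {F G : Set X}
    (hF : IsClosed F) (hG : IsOpen G) :
    {ξ | ξ ∈ F ∩ G ∧ ∀ y ∈ F ∩ G, y ⤳ ξ → y = ξ}.Finite := by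
  lift F to Closeds X using hF
  induction F using WellFoundedLT.induction with
  | _ F ih =>
  by_cases hirr : IsPreirreducible (F : Set X)
  · rcases ((F : Set X) ∩ G).eq_empty_or_nonempty with h0 | hne
    · refine Set.Finite.subset (Set.finite_empty) ?_
      rintro ξ ⟨hξ, -⟩
      rw [h0] at hξ
      exact hξ
    · have hFirr : IsIrreducible (F : Set X) := ⟨hne.mono Set.inter_subset_left, hirr⟩
      obtain ⟨ξ₀, hξ₀⟩ := QuasiSober.sober hFirr F.isClosed
      refine Set.Finite.subset (Set.finite_singleton ξ₀) ?_
      rintro ξ ⟨hξ, hmax⟩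
      exact (hmax ξ₀ ⟨hξ₀.mem, mem_of_isGenericPoint_of_isOpen hξ₀ hG hne⟩ (hξ₀.specializes hξ.1)).symm
  · rw [isPreirreducible_iff_isClosed_union_isClosed] at hirr
    push Not at hirr
    obtain ⟨z₁, z₂, hz₁, hz₂, hsub, h₁, h₂⟩ := hirr
    have hlt : ∀ {z : Set X} (hz : IsClosed z), ¬ (F : Set X) ⊆ z → F ⊓ (⟨z, hz⟩ : Closeds X) < F :=
      fun hz h => inf_lt_left.2 (fun hle => h hle)
    refine Set.Finite.subset ((ih _ (hlt hz₁ h₁)).union (ih _ (hlt hz₂ h₂))) ?_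
    rintro ξ ⟨⟨hξF, hξG⟩, hmax⟩
    have key : ∀ {z : Set X} (hz : IsClosed z), ξ ∈ z →
        ξ ∈ {ξ | ξ ∈ ((F ⊓ (⟨z, hz⟩ : Closeds X) : Closeds X) : Set X) ∩ G ∧
          ∀ y ∈ ((F ⊓ (⟨z, hz⟩ : Closeds X) : Closeds X) : Set X) ∩ G, y ⤳ ξ → y = ξ} :=
      fun hz hξz => ⟨⟨⟨hξF, hξz⟩, hξG⟩, fun y hy hyξ => hmax y ⟨hy.1.1, hy.2⟩ hyξ⟩
    rcases hsub hξF with h | h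
    exacts [Or.inl (key hz₁ h), Or.inr (key hz₂ h)]

end Literature.AlgebraicGeometry.Resolution
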